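import Summits.CriticalPhenomena.PercolationContinuityZ3.Theorems.PercNearOneGluingNoHeavyLowerTailSahiFreshCoinOrderThree
import Mathlib.Tactic.Ring
import Mathlib.Tactic.Linarith
import Mathlib.Tactic.Positivity
import HarnessLib

/-!
# OR-ing one independent event onto ALL FOUR slots multiplies `E₄` by at least `(1−p)²` — for every law

Support file for the Sahi / hitting-event programme (seat `prim-l12-p5`,
    gen 15; `--supports stmt-CriticalPhenomena-4575`).
No definitions, no named facts, no sorries; standard axioms.  Companion of `…SahiFreshCoinOrderThree` (order 3,
    all slot patterns).
Memo `run/shared/lean/prim/prim-l12/FROM-prim-l12-p5-g15-FCL-ORDER3-AND-FLOW-REDUCTION.md` §2.2.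

SETTING.  A finite type `α`, a probability weight `μ` (`ex μ`, `sahiE μ 4` = Sahi's `E₄` [Sahi2008,
    (4)–(7); LiebSahi2021,
Def. 3.1]); `{0,1}`-valued `a b d e : α → ℝ` (indicators of four events,
    repetitions allowed) and a `{0,1}`-valued `c` with
`E(c·g) = E(c)E(g)` for every product `g` of a sub-family ("independent coin"); `a ⊔ c = a + c − a·c`; `p = E(c)`.

**THEOREM (`sahiE4_or_allSlots_ge`).**  `E₄(a⊔c, b⊔c, d⊔c, e⊔c) ≥ (1 − p)²·E₄(a, b, d,
    e)`.  In particular the all-slots push-up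
preserves `E₄ ≥ 0` with NO further hypothesis on the law — in contrast with the two-slot push-up at order 4,
    which does not
(census `ttrl/coin/COIN.md` §9.2; mechanism in the memo §2.3: the merged functional `E₃(E₁∩E₂,E₃,E₄)` of an abstract law can be
negative).  PROOF: the exact identity (`order4_allSlots_core`, by `ring` in the fifteen moments)
`E₄(pushed) − (1−p)²E₄ = (1−p)p·2·P(|N| ≥ 2) + (1−p)²p·B`, `N` = set of non-occurring events, `P(|N|≥2) = 1 − Σ_i m_{S∖i} + 3m_S`,
`B = 2Σ_{ijk} n_in_jn_k + (2−p)Π n_i − Σ_{{ij}{kl}} n_{ij}n_kn_l` (`n` = co-moments), and `B ≥ ½Σ n_in_jn_k + (2−p)Πn_i ≥ 0` from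
`n_{ij} ≤ min(n_i, n_j)`.  (The order-3 analogue `E₃(pushed) = λ[λE₃ + (1−λ)X + λ(1−λ)Y]`, `λ = 1−p`, is in the companion file;
the infinitesimal form `D^S_S + 2E_S ≥ 0` of both is the memo's `Ψ_k ≥ 0`, proved there for `k ≤ 4`.) [this work]
-/

namespace Summit.CriticalPhenomena.PercolationContinuityZ3.Theorems

namespace SahiFreshCoinOrderFour

open Finset Literature.Combinatorics.Sahi2008 SahiFreshCoinOrderThree

variable {α : Type*} [Fintype α]

/-! ### Unpacking the independence hypothesis (products over sub-families of four slots) -/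

/-- The fifteen relations `E(c·g) = E(c)E(g)`, `g` a product of a nonempty sub-family of `(a,b,d,e)`, from the hypothesis
quantified over `Finset (Fin 4)`. [this work] -/
theorem indep_unpack4 (μ : α → ℝ) (a b d e c : α → ℝ)
    (hind : ∀ s : Finset (Fin 4), ex μ (c * ∏ i ∈ s, ![a, b, d, e] i) = ex μ c * ex μ (∏ i ∈ s, ![a, b, d, e] i)) :
    ex μ (c * a) = ex μ c * ex μ a ∧
    ex μ (c * b) = ex μ c * ex μ b ∧
    ex μ (c * d) = ex μ c * ex μ d ∧
    ex μ (c * e) = ex μ c * ex μ e ∧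
    ex μ (c * (a * b)) = ex μ c * ex μ (a * b) ∧
    ex μ (c * (a * d)) = ex μ c * ex μ (a * d) ∧
    ex μ (c * (a * e)) = ex μ c * ex μ (a * e) ∧
    ex μ (c * (b * d)) = ex μ c * ex μ (b * d) ∧
    ex μ (c * (b * e)) = ex μ c * ex μ (b * e) ∧
    ex μ (c * (d * e)) = ex μ c * ex μ (d * e) ∧
    ex μ (c * (a * b * d)) = ex μ c * ex μ (a * b * d) ∧
    ex μ (c * (a * b * e)) = ex μ c * ex μ (a * b * e) ∧
    ex μ (c * (a * d * e)) = ex μ c * ex μ (a * d * e) ∧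
    ex μ (c * (b * d * e)) = ex μ c * ex μ (b * d * e) ∧
    ex μ (c * (a * b * d * e)) = ex μ c * ex μ (a * b * d * e) := by
  have f0 : (![a, b, d, e] : Fin 4 → α → ℝ) 0 = a := rfl
  have f1 : (![a, b, d, e] : Fin 4 → α → ℝ) 1 = b := rfl
  have f2 : (![a, b, d, e] : Fin 4 → α → ℝ) 2 = d := rfl
  have f3 : (![a, b, d, e] : Fin 4 → α → ℝ) 3 = e := rfl
  have ia := hind {0}
  rw [prod_singleton, f0] at ia
  have ib := hind {1}
  rw [prod_singleton, f1] at ib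
  have id := hind {2}
  rw [prod_singleton, f2] at id
  have ie := hind {3}
  rw [prod_singleton, f3] at ie
  have iab := hind {0, 1}
  rw [prod_pair (by decide), f0, f1] at iab
  have iad := hind {0, 2}
  rw [prod_pair (by decide), f0, f2] at iad
  have iae := hind {0, 3}
  rw [prod_pair (by decide), f0, f3] at iae
  have ibd := hind {1, 2}
  rw [prod_pair (by decide), f1, f2] at ibd
  have ibe := hind {1, 3}
  rw [prod_pair (by decide), f1, f3] at ibe
  have ide := hind {2, 3}
  rw [prod_pair (by decide), f2, f3] at ide
  have iabd := hind {0, 1, 2}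
  rw [prod_insert (by decide), prod_pair (by decide), f0, f1, f2,
    show a * (b * d) = a * b * d from (mul_assoc _ _ _).symm] at iabd
  have iabe := hind {0, 1, 3}
  rw [prod_insert (by decide), prod_pair (by decide), f0, f1, f3,
    show a * (b * e) = a * b * e from (mul_assoc _ _ _).symm] at iabe
  have iade := hind {0, 2, 3}
  rw [prod_insert (by decide), prod_pair (by decide), f0, f2, f3,
    show a * (d * e) = a * d * e from (mul_assoc _ _ _).symm] at iade
  have ibde := hind {1, 2, 3}
  rw [prod_insert (by decide), prod_pair (by decide), f1, f2, f3,
    show b * (d * e) = b * d * e from (mul_assoc _ _ _).symm] at ibde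
  have iabde := hind {0, 1, 2, 3}
  rw [prod_insert (by decide), prod_insert (by decide), prod_pair (by decide), f0, f1, f2, f3,
    show a * (b * (d * e)) = a * b * d * e by simp only [mul_assoc]] at iabde
  exact ⟨ia, ib, id, ie, iab, iad, iae, ibd, ibe, ide, iabd, iabe, iade, ibde, iabde⟩

/-- **Order-4 core (pure algebra).**  In the fifteen moments `m_B = E(Π_B f)` and `p = E(c)`: the identity
`E₄(pushed) − (1−p)²E₄ = (1−p)p·2·PN2 + (1−p)²p·B` and the bounds `PN2 ≥ 0`, `m_{ij} ≤ min(m_i,m_j)`, `m_i ≤ 1`, `p ∈ [0,1]`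
give `E₄(pushed) ≥ (1−p)²E₄`. [this work] -/
theorem order4_allSlots_core (p ma mb md me mab mad mae mbd mbe mde mabd mabe made mbde mabde : ℝ)
    (hp0 : 0 ≤ p) (hp1 : p ≤ 1)
    (na : 0 ≤ 1 - ma) (nb : 0 ≤ 1 - mb) (nd : 0 ≤ 1 - md) (ne : 0 ≤ 1 - me)
    (lab1 : mab ≤ ma) (lab2 : mab ≤ mb) (lad1 : mad ≤ ma) (lad2 : mad ≤ md) (lae1 : mae ≤ ma) (lae2 : mae ≤ me)
    (lbd1 : mbd ≤ mb) (lbd2 : mbd ≤ md) (lbe1 : mbe ≤ mb) (lbe2 : mbe ≤ me) (lde1 : mde ≤ md) (lde2 : mde ≤ me)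
    (hPN2 : 0 ≤ (1 - (mabd + mabe + made + mbde) + 3 * mabde)) :
    (1 - p) ^ 2 * (6 * mabde - 2 * (ma * mbde + mb * made + md * mabe + me * mabd) + (ma * mb * mde + ma * md * mbe +
        ma * me * mbd + mb * md * mae + mb * me * mad + md * me * mab) - (mab * mde + mad * mbe + mae * mbd) - ma *
        mb * md * me) ≤
      6 * (mabde + p - p * mabde) - 2 * ((ma + p - p * ma) * (mbde + p - p * mbde) + (mb + p - p * mb) * (made + p -
            p * made) + (md + p - p * md) * (mabe + p - p * mabe) + (me + p - p * me) * (mabd + p - p * mabd)) +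
                ((ma +
            p - p * ma) * (mb + p - p * mb) * (mde + p - p * mde) + (ma + p - p * ma) * (md + p - p * md) * (mbe + p -
            p * mbe) + (ma + p - p * ma) * (me + p - p * me) * (mbd + p - p * mbd) + (mb + p - p * mb) * (md + p -
            p * md) * (mae + p - p * mae) + (mb + p - p * mb) * (me + p - p * me) * (mad + p - p * mad) + (md + p -
            p * md) * (me + p - p * me) * (mab + p - p * mab)) - ((mab + p - p * mab) * (mde + p - p * mde) + (mad +
                p -
            p * mad) * (mbe + p - p * mbe) + (mae + p - p * mae) * (mbd + p - p * mbd)) - (ma + p - p * ma) * (mb +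
                p -
            p * mb) * (md + p - p * md) * (me + p - p * me) := by
  have wab1 : 0 ≤ (mb - mab) * ((1 - md) * (1 - me)) := mul_nonneg (by linarith) (mul_nonneg nd ne)
  have wab2 : 0 ≤ (ma - mab) * ((1 - md) * (1 - me)) := mul_nonneg (by linarith) (mul_nonneg nd ne)
  have wad1 : 0 ≤ (md - mad) * ((1 - mb) * (1 - me)) := mul_nonneg (by linarith) (mul_nonneg nb ne)
  have wad2 : 0 ≤ (ma - mad) * ((1 - mb) * (1 - me)) := mul_nonneg (by linarith) (mul_nonneg nb ne)
  have wae1 : 0 ≤ (me - mae) * ((1 - mb) * (1 - md)) := mul_nonneg (by linarith) (mul_nonneg nb nd)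
  have wae2 : 0 ≤ (ma - mae) * ((1 - mb) * (1 - md)) := mul_nonneg (by linarith) (mul_nonneg nb nd)
  have wbd1 : 0 ≤ (md - mbd) * ((1 - ma) * (1 - me)) := mul_nonneg (by linarith) (mul_nonneg na ne)
  have wbd2 : 0 ≤ (mb - mbd) * ((1 - ma) * (1 - me)) := mul_nonneg (by linarith) (mul_nonneg na ne)
  have wbe1 : 0 ≤ (me - mbe) * ((1 - ma) * (1 - md)) := mul_nonneg (by linarith) (mul_nonneg na nd)
  have wbe2 : 0 ≤ (mb - mbe) * ((1 - ma) * (1 - md)) := mul_nonneg (by linarith) (mul_nonneg na nd)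
  have wde1 : 0 ≤ (me - mde) * ((1 - ma) * (1 - mb)) := mul_nonneg (by linarith) (mul_nonneg na nb)
  have wde2 : 0 ≤ (md - mde) * ((1 - ma) * (1 - mb)) := mul_nonneg (by linarith) (mul_nonneg na nb)
  have tabd : 0 ≤ (1 - ma) * (1 - mb) * (1 - md) := mul_nonneg (mul_nonneg na nb) nd
  have tabe : 0 ≤ (1 - ma) * (1 - mb) * (1 - me) := mul_nonneg (mul_nonneg na nb) ne
  have tade : 0 ≤ (1 - ma) * (1 - md) * (1 - me) := mul_nonneg (mul_nonneg na nd) ne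
  have tbde : 0 ≤ (1 - mb) * (1 - md) * (1 - me) := mul_nonneg (mul_nonneg nb nd) ne
  have t4 : 0 ≤ (2 - p) * ((1 - ma) * (1 - mb) * (1 - md) * (1 - me)) :=
    mul_nonneg (by linarith) (mul_nonneg (mul_nonneg (mul_nonneg na nb) nd) ne)
  have hB : 0 ≤ 2 * ((1 - ma) * (1 - mb) * (1 - md) + (1 - ma) * (1 - mb) * (1 - me) + (1 - ma) * (1 - md) * (1 -
      me) +
        (1 - mb) * (1 - md) * (1 - me)) + (2 - p) * ((1 - ma) * (1 - mb) * (1 - md) * (1 - me)) - ((1 - ma - mb +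
        mab) * (1 - md) * (1 - me) + (1 - ma - md + mad) * (1 - mb) * (1 - me) + (1 - ma - me + mae) * (1 - mb) * (1 -
        md) + (1 - mb - md + mbd) * (1 - ma) * (1 - me) + (1 - mb - me + mbe) * (1 - ma) * (1 - md) + (1 - md - me +
        mde) * (1 - ma) * (1 - mb)) := by
    linarith [wab1, wab2, wad1, wad2, wae1, wae2, wbd1, wbd2, wbe1, wbe2, wde1, wde2, tabd, tabe, tade, tbde, t4]
  have hid : (6 * (mabde + p - p * mabde) - 2 * ((ma + p - p * ma) * (mbde + p - p * mbde) + (mb + p - p * mb) *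
      (made +
        p - p * made) + (md + p - p * md) * (mabe + p - p * mabe) + (me + p - p * me) * (mabd + p - p * mabd)) +
            ((ma +
        p - p * ma) * (mb + p - p * mb) * (mde + p - p * mde) + (ma + p - p * ma) * (md + p - p * md) * (mbe + p -
        p * mbe) + (ma + p - p * ma) * (me + p - p * me) * (mbd + p - p * mbd) + (mb + p - p * mb) * (md + p -
        p * md) * (mae + p - p * mae) + (mb + p - p * mb) * (me + p - p * me) * (mad + p - p * mad) + (md + p -
        p * md) * (me + p - p * me) * (mab + p - p * mab)) - ((mab + p - p * mab) * (mde + p - p * mde) + (mad + p -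
        p * mad) * (mbe + p - p * mbe) + (mae + p - p * mae) * (mbd + p - p * mbd)) - (ma + p - p * ma) * (mb + p -
        p * mb) * (md + p - p * md) * (me + p - p * me)) - (1 - p) ^ 2 * (6 * mabde - 2 * (ma * mbde + mb * made +
        md * mabe + me * mabd) + (ma * mb * mde + ma * md * mbe + ma * me * mbd + mb * md * mae + mb * me * mad +
        md * me * mab) - (mab * mde + mad * mbe + mae * mbd) - ma * mb * md * me) =
      (1 - p) * p * (2 * (1 - (mabd + mabe + made + mbde) + 3 * mabde)) + (1 - p) ^ 2 * p * (2 * ((1 - ma) * (1 -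
          mb) * (1 - md) + (1 - ma) * (1 - mb) * (1 - me) + (1 - ma) * (1 - md) * (1 - me) + (1 - mb) * (1 - md) *
          (1 - me)) + (2 - p) * ((1 - ma) * (1 - mb) * (1 - md) * (1 - me)) - ((1 - ma - mb + mab) * (1 - md) * (1 -
          me) + (1 - ma - md + mad) * (1 - mb) * (1 - me) + (1 - ma - me + mae) * (1 - mb) * (1 - md) + (1 - mb - md +
          mbd) * (1 - ma) * (1 - me) + (1 - mb - me + mbe) * (1 - ma) * (1 - md) + (1 - md - me + mde) * (1 - ma) *
          (1 - mb))) := by ring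
  have hq : 0 ≤ 1 - p := by linarith
  have hpos : 0 ≤ (1 - p) * p * (2 * (1 - (mabd + mabe + made + mbde) + 3 * mabde)) + (1 - p) ^ 2 * p * (2 * ((1 -
        ma) * (1 - mb) * (1 - md) + (1 - ma) * (1 - mb) * (1 - me) + (1 - ma) * (1 - md) * (1 - me) + (1 - mb) * (1 -
        md) * (1 - me)) + (2 - p) * ((1 - ma) * (1 - mb) * (1 - md) * (1 - me)) - ((1 - ma - mb + mab) * (1 - md) *
            (1 -
        me) + (1 - ma - md + mad) * (1 - mb) * (1 - me) + (1 - ma - me + mae) * (1 - mb) * (1 - md) + (1 - mb - md +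
        mbd) * (1 - ma) * (1 - me) + (1 - mb - me + mbe) * (1 - ma) * (1 - md) + (1 - md - me + mde) * (1 - ma) * (1 -
        mb))) :=
    add_nonneg (mul_nonneg (mul_nonneg hq hp0) (by linarith)) (mul_nonneg (mul_nonneg (sq_nonneg _) hp0) hB)
  linarith [hid, hpos]

/-- **Order 4, all four slots, every law.**  For a probability weight `μ`, `{0,1}`-valued `a,b,d,e` and an independent
`{0,1}`-valued `c` with `p = E(c)`: `E₄(a⊔c, b⊔c, d⊔c, e⊔c) ≥ (1−p)²·E₄(a,b,d,e)`.  Proof: the exact identity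
`E₄(pushed) − (1−p)²E₄ = (1−p)p·2·P(|N| ≥ 2) + (1−p)²p·B`, `N` = set of non-occurring events,
`B = 2Σ_{ijk} n_in_jn_k + (2−p)Πn_i − Σ_{{ij}{kl}} n_{ij}n_kn_l ≥ 0` (`n` = co-moments, `n_{ij} ≤ min(n_i,n_j)`).  In particular
OR-ing a common independent coin onto ALL of four events preserves `E₄ ≥ 0` with no other hypothesis (contrast: onto TWO of four
events it does not, census `COIN.md` §9.2). [this work] -/
theorem sahiE4_or_allSlots_ge (μ : α → ℝ) (hμ : ∀ x, 0 ≤ μ x) (hμ1 : ∑ x, μ x = 1) (a b d e c : α → ℝ)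
    (ha : ∀ x, a x = 0 ∨ a x = 1) (hb : ∀ x, b x = 0 ∨ b x = 1) (hd : ∀ x, d x = 0 ∨ d x = 1)
    (he : ∀ x, e x = 0 ∨ e x = 1) (hc : ∀ x, c x = 0 ∨ c x = 1)
    (hind : ∀ s : Finset (Fin 4), ex μ (c * ∏ i ∈ s, ![a, b, d, e] i) = ex μ c * ex μ (∏ i ∈ s, ![a, b, d, e] i)) :
    (1 - ex μ c) ^ 2 * sahiE μ 4 ![a, b, d, e] ≤
      sahiE μ 4 ![a + c - a * c, b + c - b * c, d + c - d * c, e + c - e * c] := by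
  obtain ⟨ia, ib, id, ie, iab, iad, iae, ibd, ibe, ide, iabd, iabe, iade, ibde,
      iabde⟩ := indep_unpack4 μ a b d e c hind
  have one : ex μ (1 : α → ℝ) = 1 := ex_one hμ1
  have qa : ex μ ((a + c - a * c)) = ex μ a + ex μ c - ex μ c * ex μ a := by
    have hpt : (a + c - a * c) = a + c - c * a := by
      funext x; simp only [Pi.mul_apply, Pi.add_apply, Pi.sub_apply]
      rcases hc x with h | h <;> rw [h] <;> ring
    rw [hpt, ex_sub, ex_add, ia]
  have qb : ex μ ((b + c - b * c)) = ex μ b + ex μ c - ex μ c * ex μ b := by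
    have hpt : (b + c - b * c) = b + c - c * b := by
      funext x; simp only [Pi.mul_apply, Pi.add_apply, Pi.sub_apply]
      rcases hc x with h | h <;> rw [h] <;> ring
    rw [hpt, ex_sub, ex_add, ib]
  have qd : ex μ ((d + c - d * c)) = ex μ d + ex μ c - ex μ c * ex μ d := by
    have hpt : (d + c - d * c) = d + c - c * d := by
      funext x; simp only [Pi.mul_apply, Pi.add_apply, Pi.sub_apply]
      rcases hc x with h | h <;> rw [h] <;> ring
    rw [hpt, ex_sub, ex_add, id]
  have qe : ex μ ((e + c - e * c)) = ex μ e + ex μ c - ex μ c * ex μ e := by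
    have hpt : (e + c - e * c) = e + c - c * e := by
      funext x; simp only [Pi.mul_apply, Pi.add_apply, Pi.sub_apply]
      rcases hc x with h | h <;> rw [h] <;> ring
    rw [hpt, ex_sub, ex_add, ie]
  have qab : ex μ ((a + c - a * c) * (b + c - b * c)) = ex μ (a * b) + ex μ c - ex μ c * ex μ (a * b) := by
    have hpt : (a + c - a * c) * (b + c - b * c) = a * b + c - c * (a * b) := by
      funext x; simp only [Pi.mul_apply, Pi.add_apply, Pi.sub_apply]
      rcases hc x with h | h <;> rw [h] <;> ring
    rw [hpt, ex_sub, ex_add, iab]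
  have qad : ex μ ((a + c - a * c) * (d + c - d * c)) = ex μ (a * d) + ex μ c - ex μ c * ex μ (a * d) := by
    have hpt : (a + c - a * c) * (d + c - d * c) = a * d + c - c * (a * d) := by
      funext x; simp only [Pi.mul_apply, Pi.add_apply, Pi.sub_apply]
      rcases hc x with h | h <;> rw [h] <;> ring
    rw [hpt, ex_sub, ex_add, iad]
  have qae : ex μ ((a + c - a * c) * (e + c - e * c)) = ex μ (a * e) + ex μ c - ex μ c * ex μ (a * e) := by
    have hpt : (a + c - a * c) * (e + c - e * c) = a * e + c - c * (a * e) := by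
      funext x; simp only [Pi.mul_apply, Pi.add_apply, Pi.sub_apply]
      rcases hc x with h | h <;> rw [h] <;> ring
    rw [hpt, ex_sub, ex_add, iae]
  have qbd : ex μ ((b + c - b * c) * (d + c - d * c)) = ex μ (b * d) + ex μ c - ex μ c * ex μ (b * d) := by
    have hpt : (b + c - b * c) * (d + c - d * c) = b * d + c - c * (b * d) := by
      funext x; simp only [Pi.mul_apply, Pi.add_apply, Pi.sub_apply]
      rcases hc x with h | h <;> rw [h] <;> ring
    rw [hpt, ex_sub, ex_add, ibd]
  have qbe : ex μ ((b + c - b * c) * (e + c - e * c)) = ex μ (b * e) + ex μ c - ex μ c * ex μ (b * e) := by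
    have hpt : (b + c - b * c) * (e + c - e * c) = b * e + c - c * (b * e) := by
      funext x; simp only [Pi.mul_apply, Pi.add_apply, Pi.sub_apply]
      rcases hc x with h | h <;> rw [h] <;> ring
    rw [hpt, ex_sub, ex_add, ibe]
  have qde : ex μ ((d + c - d * c) * (e + c - e * c)) = ex μ (d * e) + ex μ c - ex μ c * ex μ (d * e) := by
    have hpt : (d + c - d * c) * (e + c - e * c) = d * e + c - c * (d * e) := by
      funext x; simp only [Pi.mul_apply, Pi.add_apply, Pi.sub_apply]
      rcases hc x with h | h <;> rw [h] <;> ring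
    rw [hpt, ex_sub, ex_add, ide]
  have qabd : ex μ ((a + c - a * c) * (b + c - b * c) * (d + c - d * c)) = ex μ (a * b * d) + ex μ c -
        ex μ c * ex μ (a * b * d) := by
    have hpt : (a + c - a * c) * (b + c - b * c) * (d + c - d * c) = a * b * d + c - c * (a * b * d) := by
      funext x; simp only [Pi.mul_apply, Pi.add_apply, Pi.sub_apply]
      rcases hc x with h | h <;> rw [h] <;> ring
    rw [hpt, ex_sub, ex_add, iabd]
  have qabe : ex μ ((a + c - a * c) * (b + c - b * c) * (e + c - e * c)) = ex μ (a * b * e) + ex μ c -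
        ex μ c * ex μ (a * b * e) := by
    have hpt : (a + c - a * c) * (b + c - b * c) * (e + c - e * c) = a * b * e + c - c * (a * b * e) := by
      funext x; simp only [Pi.mul_apply, Pi.add_apply, Pi.sub_apply]
      rcases hc x with h | h <;> rw [h] <;> ring
    rw [hpt, ex_sub, ex_add, iabe]
  have qade : ex μ ((a + c - a * c) * (d + c - d * c) * (e + c - e * c)) = ex μ (a * d * e) + ex μ c -
        ex μ c * ex μ (a * d * e) := by
    have hpt : (a + c - a * c) * (d + c - d * c) * (e + c - e * c) = a * d * e + c - c * (a * d * e) := by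
      funext x; simp only [Pi.mul_apply, Pi.add_apply, Pi.sub_apply]
      rcases hc x with h | h <;> rw [h] <;> ring
    rw [hpt, ex_sub, ex_add, iade]
  have qbde : ex μ ((b + c - b * c) * (d + c - d * c) * (e + c - e * c)) = ex μ (b * d * e) + ex μ c -
        ex μ c * ex μ (b * d * e) := by
    have hpt : (b + c - b * c) * (d + c - d * c) * (e + c - e * c) = b * d * e + c - c * (b * d * e) := by
      funext x; simp only [Pi.mul_apply, Pi.add_apply, Pi.sub_apply]
      rcases hc x with h | h <;> rw [h] <;> ring
    rw [hpt, ex_sub, ex_add, ibde]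
  have qabde : ex μ ((a + c - a * c) * (b + c - b * c) * (d + c - d * c) * (e + c - e * c)) = ex μ (a * b * d * e) +
        ex μ c - ex μ c * ex μ (a * b * d * e) := by
    have hpt : (a + c - a * c) * (b + c - b * c) * (d + c - d * c) * (e + c - e * c) = a * b * d * e + c -
          c * (a * b * d * e) := by
      funext x; simp only [Pi.mul_apply, Pi.add_apply, Pi.sub_apply]
      rcases hc x with h | h <;> rw [h] <;> ring
    rw [hpt, ex_sub, ex_add, iabde]
  rw [sahiE_four, sahiE_four]
  rw [qabde, qabd, qabe, qade, qbde, qab, qad, qae, qbd, qbe, qde, qa, qb, qd, qe]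
  have h01a := fun x => zeroOne_bounds ha x
  have h01b := fun x => zeroOne_bounds hb x
  have h01d := fun x => zeroOne_bounds hd x
  have h01e := fun x => zeroOne_bounds he x
  have hp := ex_zeroOne_mem hμ hμ1 hc
  have na : 0 ≤ 1 - ex μ a := by
    have : 1 - ex μ a = ex μ (1 - a) := by rw [ex_sub, one]
    rw [this]; exact ex_nonneg hμ fun x => by simp only [Pi.sub_apply, Pi.one_apply]; linarith [(h01a x).2]
  have nb : 0 ≤ 1 - ex μ b := by
    have : 1 - ex μ b = ex μ (1 - b) := by rw [ex_sub, one]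
    rw [this]; exact ex_nonneg hμ fun x => by simp only [Pi.sub_apply, Pi.one_apply]; linarith [(h01b x).2]
  have nd : 0 ≤ 1 - ex μ d := by
    have : 1 - ex μ d = ex μ (1 - d) := by rw [ex_sub, one]
    rw [this]; exact ex_nonneg hμ fun x => by simp only [Pi.sub_apply, Pi.one_apply]; linarith [(h01d x).2]
  have ne : 0 ≤ 1 - ex μ e := by
    have : 1 - ex μ e = ex μ (1 - e) := by rw [ex_sub, one]
    rw [this]; exact ex_nonneg hμ fun x => by simp only [Pi.sub_apply, Pi.one_apply]; linarith [(h01e x).2]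
  have lab1 : ex μ (a * b) ≤ ex μ a := ex_mono hμ fun x => by
    simp only [Pi.mul_apply]; exact mul_le_of_le_one_right (h01a x).1 (h01b x).2
  have lab2 : ex μ (a * b) ≤ ex μ b := ex_mono hμ fun x => by
    simp only [Pi.mul_apply]; exact mul_le_of_le_one_left (h01b x).1 (h01a x).2
  have lad1 : ex μ (a * d) ≤ ex μ a := ex_mono hμ fun x => by
    simp only [Pi.mul_apply]; exact mul_le_of_le_one_right (h01a x).1 (h01d x).2
  have lad2 : ex μ (a * d) ≤ ex μ d := ex_mono hμ fun x => by
    simp only [Pi.mul_apply]; exact mul_le_of_le_one_left (h01d x).1 (h01a x).2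
  have lae1 : ex μ (a * e) ≤ ex μ a := ex_mono hμ fun x => by
    simp only [Pi.mul_apply]; exact mul_le_of_le_one_right (h01a x).1 (h01e x).2
  have lae2 : ex μ (a * e) ≤ ex μ e := ex_mono hμ fun x => by
    simp only [Pi.mul_apply]; exact mul_le_of_le_one_left (h01e x).1 (h01a x).2
  have lbd1 : ex μ (b * d) ≤ ex μ b := ex_mono hμ fun x => by
    simp only [Pi.mul_apply]; exact mul_le_of_le_one_right (h01b x).1 (h01d x).2
  have lbd2 : ex μ (b * d) ≤ ex μ d := ex_mono hμ fun x => by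
    simp only [Pi.mul_apply]; exact mul_le_of_le_one_left (h01d x).1 (h01b x).2
  have lbe1 : ex μ (b * e) ≤ ex μ b := ex_mono hμ fun x => by
    simp only [Pi.mul_apply]; exact mul_le_of_le_one_right (h01b x).1 (h01e x).2
  have lbe2 : ex μ (b * e) ≤ ex μ e := ex_mono hμ fun x => by
    simp only [Pi.mul_apply]; exact mul_le_of_le_one_left (h01e x).1 (h01b x).2
  have lde1 : ex μ (d * e) ≤ ex μ d := ex_mono hμ fun x => by
    simp only [Pi.mul_apply]; exact mul_le_of_le_one_right (h01d x).1 (h01e x).2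
  have lde2 : ex μ (d * e) ≤ ex μ e := ex_mono hμ fun x => by
    simp only [Pi.mul_apply]; exact mul_le_of_le_one_left (h01e x).1 (h01d x).2
  have hPN2 : 0 ≤ 1 - (ex μ (a * b * d) + ex μ (a * b * e) + ex μ (a * d * e) + ex μ (b * d * e)) +
        3 * ex μ (a * b * d * e) := by
    have : 1 - (ex μ (a * b * d) + ex μ (a * b * e) + ex μ (a * d * e) + ex μ (b * d * e)) +
          3 * ex μ (a * b * d * e) =
        ex μ (1 - (a * b * d + a * b * e + a * d * e + b * d * e) + (3 : ℝ) • (a * b * d * e)) := by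
      rw [ex_add, ex_sub, ex_add, ex_add, ex_add, ex_smul, one]
    rw [this]
    refine ex_nonneg hμ fun x => ?_
    simp only [Pi.sub_apply, Pi.add_apply, Pi.mul_apply, Pi.one_apply, Pi.smul_apply, smul_eq_mul]
    rcases ha x with h1 | h1 <;> rcases hb x with h2 | h2 <;> rcases hd x with h3 | h3 <;> rcases he x with h4 | h4 <;>
      simp only [h1, h2, h3, h4] <;> norm_num
  exact order4_allSlots_core (ex μ c) (ex μ a) (ex μ b) (ex μ d) (ex μ e) (ex μ (a * b)) (ex μ (a * d)) (ex μ (a *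
      e)) (ex μ (b * d)) (ex μ (b * e)) (ex μ (d * e)) (ex μ (a * b * d)) (ex μ (a * b * e)) (ex μ (a * d *
      e)) (ex μ (b * d * e)) (ex μ (a * b * d * e))
    hp.1 hp.2 na nb nd ne lab1 lab2 lad1 lad2 lae1 lae2 lbd1 lbd2 lbe1 lbe2 lde1 lde2 hPN2


end SahiFreshCoinOrderFour

end Summit.CriticalPhenomena.PercolationContinuityZ3.Theorems
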